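import Literature.AnabelianGeometry.EtaleTheta.SettingModel2CommutatorCusp
import Literature.AnabelianGeometry.EtaleTheta.Discharge.Sec2InertiaClauseThetaLevel
import Literature.AnabelianGeometry.EtaleTheta.SettingModelAugNotOpen
import HarnessLib

/-!
# `model₂ᶜ` (commutator-axis cusp): the PER-`l` inertia clauses hold for EVERY `l` — the positive row of the
# census truth table for «inertia generates `Δ_Θ`», obtained from the `l`-free root clause through the K1 iff

S. Mochizuki, *The étale theta function and its Frobenioid-theoretic manifestations*, Publ. RIMS **45** (2009)
[EtTh], §2, discussion preceding Def. 2.1, PRIMS p. 261 (PDF p. 35): «`Δ^Θ_X ↠ Δ̄_X` … `1 → Δ̄_Θ → Δ̄_X → Δ̄^ell_X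
→ 1`», «`D_x → Π^Θ_X` … maps the inertia group `I_x ⊆ D_x` isomorphically onto `Δ_Θ`»
[cite: MochizukiEtTh2009, Def 2.1 p.35].

Cell abc-iut, layer L2; seat abc-iut-w6-d059 (gen 3); abc-iut-L2-lead (gen 4) R217 NEXT «K1 ROOT CLAUSE AT
`model₂ᶜ`».  PROOF-ONLY (0 definitions); imports abc-iut-w5-d165's `SettingModel2CommutatorCusp` (p438248: the
model `ThetaSetting.model₂c p` — `Π^tp_X := Γ × G_{ℚ_p}` untwisted, ONE cusp with `toHat(I_x) = ⟨[a,b]⟩⁻`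
(`map_toHat_inertia_model₂c`) and the ROOT clause `toTheta(I_x) = Δ_Θ` (`map_toTheta_inertia_model₂c`)) and this
seat's `Discharge/Sec2InertiaClauseThetaLevel` / `…EllFree` (p437083 / p436885: the K1 iff «per-`l` for all
`l > 0` ⟺ `toTheta(I_x) = Ker(thetaToEll)`» for a compact image `toHat(I_x)`), all BY NAME.

The root clause itself is ALREADY in the tree at `model₂ᶜ` (p438248, census token
`SettingModel.map_toTheta_inertia_model₂c`).  Recorded here is what the K1 iff makes of it:

* `isCompact_map_toHat_inertia_model₂c` — `toHat(I_x) = ⟨[a,b]⟩⁻` is closed in the profinite `Π_X`, hence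
  compact (NOTE: the decomposition group `D_x = c^Ẑ × G_{ℚ_p}` itself is NOT compact in `Π^tp_X`, the arithmetic
  factor of `model₂` being DISCRETE — `not_isCompact_decomp_model₂c`; the K1 iff needs only the compact IMAGE);
* `map_inertia_sup_closure_eq_model₂c` — the profinite form of the root clause,
  `toHat(I_x) ⊔ [Δ_X,[Δ_X,Δ_X]]⁻ = [Δ_X,Δ_X]⁻`, from `map_toTheta_inertia_model₂c` through
  `map_sup_closure_eq_iff_map_toTheta_eq_ker`;
* **`inertiaClause_model₂c`** — for EVERY `l : ℕ` (no parity, no `l > 0`):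
  `toHat(I_x) ⊔ barKerHat l = barThetaHat l` at `model₂ᶜ` (`sup_barKerHat_eq_of_sup_closure_eq`): the per-`l`
  «`I_x ⥲ Δ̄_Θ` modulo `Ker(Δ_X ↠ Δ̄_X)`» binder family `hIx` (G-L2t10-3, reduced form p432830) HOLDS at a model
  WITH a cusp — the positive twin of abc-iut-L2-t10's certificates that it FAILS for every `l ≥ 2` at the
  toral-cusp models `curveχ′` / `curveχq′` (p433801, `stageTwo_census`);
* `forall_inertiaClause_iff_model₂c` — the K1 iff instantiated (both sides true here);
* **`ThetaSetting.exists_isEtThOrigin_cusp_forall_inertiaClause`** — census summary: root interface + guard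
  `IsEtThOrigin` + a cusp at which the root clause AND every per-`l` clause hold are JOINTLY SATISFIABLE.

HONEST LABEL: `model₂ᶜ` is abc-iut-w5-d165's SEMI-SYNTHETIC model (the arithmetic factor acts trivially on `Γ`);
consistency evidence only — not the tempered `π₁` of a once-punctured elliptic curve; nothing of [EtTh] is
asserted; no new `Prop` fact, no definition, no edit of another seat's file; no side taken on [IUTchIII] Cor. 3.12.
-/

noncomputable section

namespace Literature.AnabelianGeometry.EtaleTheta.SettingModel

open Literature.AnabelianGeometry.SemiGraphs _root_.Topology
open scoped commutatorElement

variable (p : ℕ) [Fact p.Prime]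

/-- `toHat(I_x) ≤ Π_X` is CLOSED at `model₂ᶜ` (it is the closure `⟨[a,b]⟩⁻`). [cite: MochizukiEtTh2009, Def 2.1 p.35] -/
theorem isClosed_map_toHat_inertia_model₂c (x : (ThetaSetting.model₂c p).Pt) :
    IsClosed ((((ThetaSetting.model₂c p).inertia x).map (ThetaSetting.model₂c p).toHat.toMonoidHom :
      Subgroup (ThetaSetting.model₂c p).PiHat) : Set (ThetaSetting.model₂c p).PiHat) := by
  rw [map_toHat_inertia_model₂c]
  exact Subgroup.isClosed_topologicalClosure _

/-- `toHat(I_x)` is COMPACT at `model₂ᶜ` (closed in the profinite `Π_X`). [cite: MochizukiEtTh2009, Def 2.1 p.35] -/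
theorem isCompact_map_toHat_inertia_model₂c (x : (ThetaSetting.model₂c p).Pt) :
    IsCompact ((((ThetaSetting.model₂c p).inertia x).map (ThetaSetting.model₂c p).toHat.toMonoidHom :
      Subgroup (ThetaSetting.model₂c p).PiHat) : Set (ThetaSetting.model₂c p).PiHat) := by
  haveI : CompactSpace (ThetaSetting.model₂c p).PiHat :=
    (ThetaSetting.model₂c p).isProfiniteCompletion_toHat.compactSpace
  exact (isClosed_map_toHat_inertia_model₂c p x).isCompact

/-- HONEST NOTE: the decomposition group `D_x = c^Ẑ × G_{ℚ_p}` of `model₂ᶜ` is NOT compact in `Π^tp_X = Γ × G_{ℚ_p}`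
— the arithmetic factor of `model₂` carries the DISCRETE topology and `G_{ℚ_p}` is infinite; so the cusp-level
wrappers of the K1 iff (stated for compact `D_x`) are bypassed here through the compact IMAGE `toHat(I_x)`.
[cite: MochizukiSemiAnbd2006, §6 p.71] -/
theorem not_isCompact_decomp_model₂c (x : (ThetaSetting.model₂c p).Pt) :
    ¬ IsCompact ((ThetaSetting.model₂c p).decomp x : Set (ThetaSetting.model₂c p).PiTemp) := by
  intro h
  -- the second projection of `D_x = c^Ẑ × ⊤` is all of the discrete, infinite `G_{ℚ_p}`
  have himg : (Prod.snd '' ((ThetaSetting.model₂c p).decomp x : Set (ThetaSetting.model₂c p).PiTemp)) =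
      (Set.univ : Set (Gam p)) := by
    refine Set.eq_univ_of_forall fun σ => ⟨((1 : Gfp), σ), ?_, rfl⟩
    change ((1 : Gfp), σ) ∈ cuspDecomp₂c p
    exact (mem_cuspDecomp₂c_iff p _).mpr (one_mem _)
  have hc : IsCompact (Set.univ : Set (Gam p)) := himg ▸ h.image continuous_snd
  haveI : Infinite (GQp p) := infinite_GQp p
  haveI : Infinite (Gam p) := inferInstanceAs (Infinite (GQp p))
  exact (Set.infinite_univ (α := Gam p)) (hc.finite_of_discrete)

/-- **The profinite form of the root clause at `model₂ᶜ`**: `toHat(I_x) ⊔ [Δ_X,[Δ_X,Δ_X]]⁻ = [Δ_X,Δ_X]⁻` — from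
abc-iut-w5-d165's `map_toTheta_inertia_model₂c` (`toTheta(I_x) = Δ_Θ`) through the tempered ⟺ profinite bridge
`map_sup_closure_eq_iff_map_toTheta_eq_ker` (compact image). [cite: MochizukiEtTh2009, Def 2.1 p.35] -/
theorem map_inertia_sup_closure_eq_model₂c (x : (ThetaSetting.model₂c p).Pt) :
    ((ThetaSetting.model₂c p).inertia x).map (ThetaSetting.model₂c p).toHat.toMonoidHom ⊔
        (⁅⁅(ThetaSetting.model₂c p).DeltaHat, (ThetaSetting.model₂c p).DeltaHat⁆,
          (ThetaSetting.model₂c p).DeltaHat⁆).topologicalClosure =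
      (⁅(ThetaSetting.model₂c p).DeltaHat, (ThetaSetting.model₂c p).DeltaHat⁆).topologicalClosure :=
  ((ThetaSetting.model₂c p).map_sup_closure_eq_iff_map_toTheta_eq_ker _
    (isCompact_map_toHat_inertia_model₂c p x)).mpr (map_toTheta_inertia_model₂c p x)

/-- **The per-`l` inertia clause HOLDS at `model₂ᶜ` for EVERY `l`**: `toHat(I_x) ⊔ barKerHat l = barThetaHat l`
(«`I_x ⥲ Δ̄_Θ` modulo `Ker(Δ_X ↠ Δ̄_X)`», the reduced binder `hIx` of G-L2t10-3) — root clause ⟹ per-`l` by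
`sup_barKerHat_eq_of_sup_closure_eq`.  Positive twin of `SettingModel.not_inertiaClause_curveχ'` (every `l ≥ 2`).
[cite: MochizukiEtTh2009, Def 2.1 p.35] -/
theorem inertiaClause_model₂c (x : (ThetaSetting.model₂c p).Pt) (l : ℕ) :
    ((ThetaSetting.model₂c p).inertia x).map (ThetaSetting.model₂c p).toHat.toMonoidHom ⊔
        (ThetaSetting.model₂c p).barKerHat l = (ThetaSetting.model₂c p).barThetaHat l :=
  (ThetaSetting.model₂c p).sup_barKerHat_eq_of_sup_closure_eq _ (isCompact_map_toHat_inertia_model₂c p x)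
    (map_inertia_sup_closure_eq_model₂c p x) l

/-- The per-`l` family for all `l > 0`, in the shape of the K1 iff's left-hand side. [cite: MochizukiEtTh2009, Def 2.1 p.35] -/
theorem forall_inertiaClause_model₂c (x : (ThetaSetting.model₂c p).Pt) :
    ∀ l, 0 < l → ((ThetaSetting.model₂c p).inertia x).map (ThetaSetting.model₂c p).toHat.toMonoidHom ⊔
      (ThetaSetting.model₂c p).barKerHat l = (ThetaSetting.model₂c p).barThetaHat l :=
  fun l _ => inertiaClause_model₂c p x l

/-- **The K1 iff at `model₂ᶜ`** (both sides hold): «per-`l` for all `l > 0`» ⟺ «`toTheta(I_x) = Ker(thetaToEll)`»,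
through the compact image `toHat(I_x)`. [cite: MochizukiEtTh2009, Def 2.1 p.35] -/
theorem forall_inertiaClause_iff_model₂c (x : (ThetaSetting.model₂c p).Pt) :
    (∀ l, 0 < l → ((ThetaSetting.model₂c p).inertia x).map (ThetaSetting.model₂c p).toHat.toMonoidHom ⊔
        (ThetaSetting.model₂c p).barKerHat l = (ThetaSetting.model₂c p).barThetaHat l) ↔
      ((ThetaSetting.model₂c p).inertia x).map (ThetaSetting.model₂c p).toTheta =
        (ThetaSetting.model₂c p).thetaToEll.ker := by
  rw [(ThetaSetting.model₂c p).forall_sup_barKerHat_eq_iff _ (isCompact_map_toHat_inertia_model₂c p x),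
    (ThetaSetting.model₂c p).map_sup_closure_eq_iff_map_toTheta_eq_ker _
      (isCompact_map_toHat_inertia_model₂c p x)]

/-- **CENSUS SUMMARY (C3 positive witness).** There is a `ThetaSetting p` satisfying the guard `IsEtThOrigin` with a
cusp `x` at which the `l`-free root clause `toTheta(I_x) = Δ_Θ` AND the per-`l` clause
`toHat(I_x) ⊔ barKerHat l = barThetaHat l` for EVERY `l` hold together — witnessed by abc-iut-w5-d165's
semi-synthetic `model₂ᶜ`.  With abc-iut-L2-t10's `exists_cusp_inertiaClause_fails` (curveχ′) the typed clause takes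
both truth values across the model zoo.  [cite: MochizukiEtTh2009, Def 2.1 p.35] -/
theorem _root_.Literature.AnabelianGeometry.EtaleTheta.ThetaSetting.exists_isEtThOrigin_cusp_forall_inertiaClause :
    ∃ D : ThetaSetting p, D.IsEtThOrigin ∧ ∃ x : D.Pt, D.IsCusp x ∧
      (D.inertia x).map D.toTheta = D.DeltaTheta ∧
      ∀ l : ℕ, (D.inertia x).map D.toHat.toMonoidHom ⊔ D.barKerHat l = D.barThetaHat l :=
  ⟨ThetaSetting.model₂c p, ThetaSetting.model₂c_isEtThOrigin p, (), trivial, map_toTheta_inertia_model₂c p (),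
    inertiaClause_model₂c p ()⟩

end Literature.AnabelianGeometry.EtaleTheta.SettingModel

end
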